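import Literature.NumberTheory.EllipticCurves.Kim2025.CorankStructureOPEN
import HarnessLib

/-!
# Kim 2025, Conjecture 1.6 ("discrete Beilinson–Bloch–Kato"): `ord_{s=k/2} L(f,s) = ord(δ^{min,†})`
# — TYPED for elliptic curves over `ℚ` as a conjecture leaf (nothing asserted)

STAGED by the cross-ladder literature-typing layer (cell `bsd-littype`, seat 09; D-0088(4)) for a
planner to file under `Summits/BirchSwinnertonDyer/<Sub>/Theorems/` (`--kind statement`): conjectures
are not Literature (CONVENTIONS §4). Proposed home: `Summits/BirchSwinnertonDyer/Rank1Residual/X4/`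
next to the sibling leaf `KimTamagawaDefect` (Kim AJM Conj. 1.9/1.10 = Kim 2025 Conj. 7.1 for
elliptic curves), whose conventions (cyclic levels, `Ω⁺_f`-normalised Kurihara numbers of the newform
`f` of `W`) are used verbatim. HONEST FRAMING (cell, verbatim): "no tranche here proves BSD … typed ≠
proved ≠ endorsed".

## The printed statement (C.-H. Kim, arXiv:2505.09121v1 (2025, PREPRINT), §1.3.1, held TeX text
`paper:arxiv-2505.09121` chunk p0006:L25–L31)

"It is natural to ask the compatibility between the Beilinson–Bloch–Kato conjecture for modular forms
and our discrete analogue. The conjecture below is the comparison between two very different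
variations of the same `L`-value `L(f, k/2)` and can be viewed as another quantitative refinement of
the non-vanishing question of `δ^{min,†}`. … **Conjecture 1.6 (Beilinson–Bloch–Kato).** Let
`f ∈ S_k(Γ₀(N))` be a newform and `p ≥ 3` a prime such that `ρ_f` has large image. Then
`ord_{s=k/2} L(f,s) = ord(δ^{min,†})`." With §1.1.3 (chunk p0004:L31–L55): the analogy
`ord(δ^{min,r}) ↭ ord_{s=r} L(f̄,s)`, `∂^{(i)}(δ^{min,r}) ↭ L^{(i)}(f̄,r)`.

KNOWN CASES IN PRINT (weight `2`, elliptic curves): `ord_{s=1} L ≤ 1` and `p² ∤ N` — Cor. 1.10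
(tree: `Kim2025.thm12_kuriharaVanishingOrder_eq_one_of_analyticRank_eq_one_OPEN`, rank `0` trivially
`kuriharaVanishingOrder_eq_zero_of_ratPlusSymbol_ne_zero`). By Thm. 1.1 ("BSD", corank clause; tree:
`Kim2025.thm11_selmerCorank_eq_of_kuriharaVanishingOrder_eq_OPEN`) the conjecture is, whenever
`δ^{min}` does not vanish, EQUIVALENT to `ord_{s=1} L(E,s) = corank_{ℤ_p} Sel_{p^∞}(E/ℚ)` — the rank
part of BSD plus `corank_{ℤ_p} Ш(E/ℚ)[p^∞] = 0`; its content beyond BSD is the case where the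
collection vanishes identically (`ord = ∞`), excluded conjecturally by Thm. 1.2 / Kurihara's conjecture.

## The typed shapes (E = `f_E`, `k = 2`; dictionary of `Kim2025/CorankStructureOPEN`)

`KimDiscreteBBKAt W p f : (W.analyticRank : ℕ∞) = kuriharaVanishingOrder W p f` (per pair, with the
newform `f` of `W`; `ℕ∞`-valued right side: `⊤` iff the collection vanishes on all cyclic levels),
and the printed sentence `kim2025_conjecture_1_6` (binders `3 ≤ p`, tower, newform, `Ω⁺_f` an
integral period — the binder shape of every `Kim2025.*_OPEN` decl). Nothing asserted; OPEN.
-/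

noncomputable section

open scoped Classical MatrixGroups ModularForm

open CongruenceSubgroup WeierstrassCurve Literature.NumberTheory.EllipticCurves
  Literature.NumberTheory.EllipticCurves.ModularForms

namespace Summit.BirchSwinnertonDyer.Rank1Residual.X4

/-- **Kim 2025, Conjecture 1.6 at `(E, p)` — TYPED** ("`ord_{s=k/2} L(f,s) = ord(δ^{min,†})`", read
at `k = 2` for the newform `f` of the globally minimal curve `W`): the analytic rank equals the
vanishing order of the collection of (`Ω⁺_f`-normalised, cyclic-level) Kurihara numbers, in `ℕ∞`.
A predicate; nothing asserted; OPEN (known in print only for `ord_{s=1} L ≤ 1`, `p² ∤ N`: Cor. 1.10).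
[cite: Kim2025RefinedTNC, Conj. 1.6 (§1.3.1, held chunk p0006:L28–L31)] -/
@[conjecture] def KimDiscreteBBKAt (W : WeierstrassCurve ℚ) [W.IsGloballyMinimal] (p : ℕ)
    {N : ℕ} (f : CuspForm (Gamma0 N) 2) : Prop :=
  (W.analyticRank : ℕ∞) = kuriharaVanishingOrder W p f

/-- **Kim 2025, Conjecture 1.6, the printed sentence — TYPED** ("Let `f ∈ S_k(Γ₀(N))` be a newform
and `p ≥ 3` a prime such that `ρ_f` has large image. Then `ord_{s=k/2} L(f,s) = ord(δ^{min,†})`"),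
in the binder shape of the tree's `Kim2025.*_OPEN` decls (globally minimal `W`, `3 ≤ p`, tower
`ρ̄_{E,p^n}` onto for all `n`, newform `f` of `W`, `Ω⁺_f` an integral period). Nothing asserted; OPEN.
[cite: Kim2025RefinedTNC, Conj. 1.6 (§1.3.1, held chunk p0006:L28–L31)] -/
@[conjecture] def kim2025_conjecture_1_6 : Prop :=
  ∀ (W : WeierstrassCurve ℚ) [W.IsElliptic] [W.IsGloballyMinimal] (p : ℕ) [Fact p.Prime],
    3 ≤ p → (∀ n : ℕ, W.HasSurjectiveModNGaloisRep (p ^ n : ℕ)) →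
    ∀ {N : ℕ} [NeZero N] (f : CuspForm (Gamma0 N) 2), IsNewformOf W f →
    (∀ r : ℚ, ratPlusSymbol f r ≠ 0 → 0 ≤ padicValRat p (ratPlusSymbol f r)) →
    KimDiscreteBBKAt W p f

/-! ### Bookkeeping (proved): the conjecture with Thm. 1.1's corank clause gives `r_an = cork Sel` -/

/-- **Conj. 1.6 + Thm. 1.1 ("BSD", corank clause) ⇒ `ord_{s=1} L(E,s) = corank_{ℤ_p} Sel_{p^∞}(E/ℚ)`**
at every `p ≥ 3` under large image with `Ω⁺_f` integral — the reading "discrete BBK is BSD-rank plus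
`Ш[p^∞]`-cofiniteness modulo the structure theorem" of the module docstring. Both inputs are OPEN
(`Prop` hypotheses); nothing asserted beyond the implication.
[cite: Kim2025RefinedTNC, Conj. 1.6 and Thm. 1.1 ("BSD") (held chunks p0006, p0004)] -/
theorem analyticRank_eq_selmerCorank_of_kimDiscreteBBK
    (h16 : kim2025_conjecture_1_6)
    (h11 : Kim2025.thm11_selmerCorank_eq_of_kuriharaVanishingOrder_eq_OPEN)
    (W : WeierstrassCurve ℚ) [W.IsElliptic] [W.IsGloballyMinimal] (p : ℕ) [Fact p.Prime]
    (hp : 3 ≤ p) (htower : ∀ n : ℕ, W.HasSurjectiveModNGaloisRep (p ^ n : ℕ))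
    {N : ℕ} [NeZero N] (f : CuspForm (Gamma0 N) 2) (hf : IsNewformOf W f)
    (hint : ∀ r : ℚ, ratPlusSymbol f r ≠ 0 → 0 ≤ padicValRat p (ratPlusSymbol f r)) :
    W.selmerCorank p = W.analyticRank :=
  h11 W p hp htower f hf hint W.analyticRank (h16 W p hp htower f hf hint).symm

end Summit.BirchSwinnertonDyer.Rank1Residual.X4

end
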